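import Summits.RiemannHypothesis.RiemannHypothesis.Theorems.PfPersistenceGalerkinFormRadiusArch
import HarnessLib

/-!
# GAL-1 piece (ii′), STEP A: the cut-off form functional along a SEQUENCE OF PROFILES at fixed radius

Cell `pub-rhpf` (even-sector Pólya-frequency campaign; a long-odds MECHANISM SEARCH — no RH claims),
seat `barrier-prover` g2. RH-free analysis; nothing about `RiemannHypothesis` is asserted.

`PfPersistenceGalerkinFormRadius` / `…RadiusArch` moved the truncation RADIUS of one fixed `C¹` function.
This file is the companion engine for GAL-1 (ii′) `TestToProfileFormDensity`: the radius `a` is FIXED and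
the FUNCTION moves along a sequence `F_N → f`. With `cutoffAt a h = 1_{[-a,a]} h` and
`autocorrAt a h = (1_{[-a,a]} h) ⋆ (1_{[-a,a]} h)~`:

* `tendsto_form_and_mass_cutoffAt_seq` : if the `F_N` are `C¹`, uniformly bounded by `M` on `[-a, a]`,
  with `∫_{-a}^{a} ‖F_N'‖ ≤ D`, and `F_N → f` POINTWISE on `[-a, a]` (`f` continuous), then
  `W(autocorrAt a F_N) → W(autocorrAt a f)` and `∫ ‖cutoffAt a F_N‖² → ∫ ‖cutoffAt a f‖²`.

Term by term: mass, Mellin values and window values `A(x) = ∫_{overlap} F(u) conj F(u-x) du` by dominated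
convergence on bounded intervals (constant majorants); the prime term is ONE finite sum of window values;
the archimedean integral by dominated convergence on `ℝ` with the majorant `K (1+|t|)^{-3/2}`,
`K = K(a, M, D)` coming from the one-step integration-by-parts decay
`‖(1_{[-a,a]} F_N)^(½+it)‖ ≤ C(a, M, D)/(1+|t|)` (`norm_weilMellin_cutoffAt_half_le_of_bounds`) and the digamma
weight bound `|Re ψ(¼+it/2)| ≤ log(3+|t|) + 12`.

Intended use (next files): `F_N = P_N g`, the window cosine (Fourier) truncations of a smooth even test `g`
flat at `±a`, whose coefficients decay like `n^{-3}`.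
-/

noncomputable section

open Complex Filter Set MeasureTheory Topology
open scoped Real ComplexConjugate Interval

namespace Summit.RiemannHypothesis.RiemannHypothesis.Theorems.PfPersistence

open Literature.NumberTheory.LFunctions

variable {F : ℕ → ℝ → ℂ} {f : ℝ → ℂ} {a M : ℝ}

/-! ## §1 Dominated convergence on a bounded interval with a constant majorant -/

/-- Interval dominated convergence with a constant majorant, hypotheses on `Ι a b` only. [folklore] -/
theorem tendsto_intervalIntegral_of_bdd {E : Type*} [NormedAddCommGroup E] [NormedSpace ℝ E]
    [CompleteSpace E] {lo hi K : ℝ} {G : ℕ → ℝ → E} {g : ℝ → E} (hGc : ∀ N, Continuous (G N))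
    (hK : ∀ N, ∀ x ∈ Ι lo hi, ‖G N x‖ ≤ K)
    (hlim : ∀ x ∈ Ι lo hi, Tendsto (fun N ↦ G N x) atTop (𝓝 (g x))) :
    Tendsto (fun N ↦ ∫ x in lo..hi, G N x) atTop (𝓝 (∫ x in lo..hi, g x)) :=
  intervalIntegral.tendsto_integral_filter_of_dominated_convergence (fun _ ↦ K)
    (Eventually.of_forall fun N ↦ (hGc N).aestronglyMeasurable)
    (Eventually.of_forall fun N ↦ ae_of_all _ (hK N)) intervalIntegrable_const (ae_of_all _ hlim)

/-- `Ι (-a) a ⊆ [-a, a]`. [folklore] -/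
theorem mem_Icc_of_mem_uIoc_symm {a x : ℝ} (ha : 0 ≤ a) (hx : x ∈ Ι (-a) a) : x ∈ Icc (-a) a := by
  rw [uIoc_of_le (by linarith)] at hx
  exact ⟨hx.1.le, hx.2⟩

/-! ## §2 Mass, Mellin values and window values along the sequence -/

/-- **Mass**: `∫ ‖cutoffAt a F_N‖² → ∫ ‖cutoffAt a f‖²`. [folklore] -/
theorem tendsto_integral_norm_sq_cutoffAt_seq (ha : 0 ≤ a) (hFc : ∀ N, Continuous (F N))
    (hM : ∀ N, ∀ x ∈ Icc (-a) a, ‖F N x‖ ≤ M)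
    (hpt : ∀ x ∈ Icc (-a) a, Tendsto (fun N ↦ F N x) atTop (𝓝 (f x))) :
    Tendsto (fun N ↦ ∫ t, ‖cutoffAt a (F N) t‖ ^ 2) atTop (𝓝 (∫ t, ‖cutoffAt a f t‖ ^ 2)) := by
  simp only [integral_norm_sq_cutoffAt _ ha]
  have hM0 : 0 ≤ M := (norm_nonneg _).trans (hM 0 0 ⟨by linarith, ha⟩)
  refine tendsto_intervalIntegral_of_bdd (K := M ^ 2) (fun N ↦ (hFc N).norm.pow 2)
    (fun N x hx ↦ ?_) (fun x hx ↦ ?_)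
  · rw [Real.norm_eq_abs, abs_of_nonneg (by positivity)]
    exact pow_le_pow_left₀ (norm_nonneg _) (hM N x (mem_Icc_of_mem_uIoc_symm ha hx)) 2
  · exact ((continuous_norm.pow 2).tendsto _).comp (hpt x (mem_Icc_of_mem_uIoc_symm ha hx))

/-- **Mellin values**: `(cutoffAt a F_N)^(s) → (cutoffAt a f)^(s)`. [folklore] -/
theorem tendsto_weilMellin_cutoffAt_seq (ha : 0 ≤ a) (hFc : ∀ N, Continuous (F N))
    (hM : ∀ N, ∀ x ∈ Icc (-a) a, ‖F N x‖ ≤ M)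
    (hpt : ∀ x ∈ Icc (-a) a, Tendsto (fun N ↦ F N x) atTop (𝓝 (f x))) (s : ℂ) :
    Tendsto (fun N ↦ weilMellin (cutoffAt a (F N)) s) atTop (𝓝 (weilMellin (cutoffAt a f) s)) := by
  simp only [weilMellin_cutoffAt_eq _ ha]
  obtain ⟨E, hE⟩ := isCompact_Icc.exists_bound_of_continuousOn (s := Icc (-a) a)
    ((by fun_prop : Continuous fun x : ℝ ↦ cexp ((s - 1 / 2) * x)).continuousOn)
  refine tendsto_intervalIntegral_of_bdd (K := M * E) (fun N ↦ (hFc N).mul (by fun_prop))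
    (fun N x hx ↦ ?_) (fun x hx ↦ ?_)
  · have hx' := mem_Icc_of_mem_uIoc_symm ha hx
    rw [norm_mul]
    exact mul_le_mul (hM N x hx') (hE x hx') (norm_nonneg _)
      ((norm_nonneg _).trans (hM N x hx'))
  · exact (hpt x (mem_Icc_of_mem_uIoc_symm ha hx)).mul_const _

/-- Points of the (oriented) overlap interval lie in the window, and so do their `x`-translates.
[folklore] -/
theorem mem_window_of_mem_uIoc_overlap {a x u : ℝ}
    (hu : u ∈ Ι (overlapLeft a x) (overlapRight a x)) :
    u ∈ Icc (-a) a ∧ u - x ∈ Icc (-a) a := by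
  rw [uIoc_of_le (overlapLeft_le_overlapRight a x)] at hu
  obtain ⟨h1, h2⟩ := hu
  have hlt : overlapLeft a x < overlapRight a x := h1.trans_le h2
  have hR : overlapRight a x = min a (x + a) := by
    unfold overlapRight at hlt ⊢
    rcases le_or_gt (min a (x + a)) (overlapLeft a x) with h | h
    · rw [max_eq_left h] at hlt; exact absurd hlt (lt_irrefl _)
    · exact max_eq_right h.le
  rw [hR] at h2
  have hL1 : -a ≤ overlapLeft a x := le_max_left _ _
  have hL2 : x - a ≤ overlapLeft a x := le_max_right _ _
  have h2a : u ≤ a := h2.trans (min_le_left _ _)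
  have h2b : u ≤ x + a := h2.trans (min_le_right _ _)
  exact ⟨⟨by linarith, h2a⟩, ⟨by linarith, by linarith⟩⟩

/-- **Window values**: `autocorrAt a F_N x → autocorrAt a f x`. [folklore] -/
theorem tendsto_autocorrAt_apply_seq (hFc : ∀ N, Continuous (F N))
    (hM : ∀ N, ∀ x ∈ Icc (-a) a, ‖F N x‖ ≤ M)
    (hpt : ∀ x ∈ Icc (-a) a, Tendsto (fun N ↦ F N x) atTop (𝓝 (f x))) (x : ℝ) :
    Tendsto (fun N ↦ autocorrAt a (F N) x) atTop (𝓝 (autocorrAt a f x)) := by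
  have heq : ∀ h : ℝ → ℂ, autocorrAt a h x =
      ∫ u in (overlapLeft a x)..(overlapRight a x), h u * conj (h (u - x)) :=
    fun h ↦ weilConv_weilReflect_cutoff_eq h a x
  simp only [heq]
  refine tendsto_intervalIntegral_of_bdd (K := M * M)
    (fun N ↦ (hFc N).mul (Complex.continuous_conj.comp ((hFc N).comp (continuous_id.sub
      continuous_const)))) (fun N u hu ↦ ?_) (fun u hu ↦ ?_)
  · obtain ⟨h1, h2⟩ := mem_window_of_mem_uIoc_overlap hu
    rw [norm_mul, Complex.norm_conj]
    exact mul_le_mul (hM N u h1) (hM N _ h2) (norm_nonneg _) ((norm_nonneg _).trans (hM N u h1))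
  · obtain ⟨h1, h2⟩ := mem_window_of_mem_uIoc_overlap hu
    exact (hpt u h1).mul ((Complex.continuous_conj.tendsto _).comp (hpt _ h2))

/-! ## §3 Prime and polar terms, and the value at `0` -/

/-- **Prime term** along the sequence (one finite sum of window values). [folklore] -/
theorem tendsto_weilPrimeTerm_autocorrAt_seq (hFc : ∀ N, Continuous (F N))
    (hM : ∀ N, ∀ x ∈ Icc (-a) a, ‖F N x‖ ≤ M)
    (hpt : ∀ x ∈ Icc (-a) a, Tendsto (fun N ↦ F N x) atTop (𝓝 (f x))) :
    Tendsto (fun N ↦ weilPrimeTerm (autocorrAt a (F N))) atTop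
      (𝓝 (weilPrimeTerm (autocorrAt a f))) := by
  simp only [weilPrimeTerm_autocorrAt_eq_sum _ (le_refl a)]
  refine tendsto_finsetSum _ fun m _ ↦ ?_
  exact ((tendsto_autocorrAt_apply_seq hFc hM hpt _).add
    (tendsto_autocorrAt_apply_seq hFc hM hpt _)).const_mul _

/-- **Polar term** along the sequence. [folklore] -/
theorem tendsto_weilPolarTerm_autocorrAt_seq (ha : 0 ≤ a) (hFc : ∀ N, Continuous (F N))
    (hfc : Continuous f) (hM : ∀ N, ∀ x ∈ Icc (-a) a, ‖F N x‖ ≤ M)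
    (hpt : ∀ x ∈ Icc (-a) a, Tendsto (fun N ↦ F N x) atTop (𝓝 (f x))) :
    Tendsto (fun N ↦ weilPolarTerm (autocorrAt a (F N))) atTop
      (𝓝 (weilPolarTerm (autocorrAt a f))) := by
  have hMl := fun s ↦ tendsto_weilMellin_cutoffAt_seq ha hFc hM hpt s
  have hconj : ∀ s : ℂ, Tendsto (fun N ↦ conj (weilMellin (cutoffAt a (F N)) s)) atTop
      (𝓝 (conj (weilMellin (cutoffAt a f) s))) :=
    fun s ↦ (Complex.continuous_conj.tendsto _).comp (hMl s)
  have e : ∀ N, weilPolarTerm (autocorrAt a (F N)) =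
      weilMellin (cutoffAt a (F N)) 0 * conj (weilMellin (cutoffAt a (F N)) (1 - conj 0)) +
        weilMellin (cutoffAt a (F N)) 1 * conj (weilMellin (cutoffAt a (F N)) (1 - conj 1)) := by
    intro N; simp only [weilPolarTerm, weilMellin_autocorrAt (hFc N)]
  rw [funext e, weilPolarTerm, weilMellin_autocorrAt hfc a 0, weilMellin_autocorrAt hfc a 1]
  exact ((hMl 0).mul (hconj _)).add ((hMl 1).mul (hconj _))

/-! ## §4 Uniform decay on the critical line from the bounds `M`, `D` -/

/-- **One-step integration-by-parts decay with explicit constant**: if `h ∈ C¹`, `‖h‖ ≤ M` on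
`[-a, a]` and `∫_{-a}^{a} ‖h'‖ ≤ D`, then `‖(1_{[-a,a]} h)^(½+it)‖ ≤ 2·max(2aM, 2M+D)/(1+|t|)`.
[folklore] -/
theorem norm_weilMellin_cutoffAt_half_le_of_bounds {h h' : ℝ → ℂ} {D : ℝ} (ha : 0 ≤ a)
    (hh : ∀ x, HasDerivAt h (h' x) x) (hh' : Continuous h') (hM0 : 0 ≤ M)
    (hM : ∀ x ∈ Icc (-a) a, ‖h x‖ ≤ M) (hD : (∫ x in (-a)..a, ‖h' x‖) ≤ D) (t : ℝ) :
    ‖weilMellin (cutoffAt a h) (1 / 2 + t * I)‖ ≤ 2 * max (2 * a * M) (2 * M + D) / (1 + |t|) := by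
  have hhc : Continuous h := continuous_iff_continuousAt.2 fun x ↦ (hh x).continuousAt
  have haa : -a ≤ a := by linarith
  rw [weilMellin_cutoffAt_half_eq h ha]
  set C₀ : ℝ := 2 * a * M
  set C₁ : ℝ := 2 * M + D
  have hD0 : 0 ≤ D :=
    (intervalIntegral.integral_nonneg haa fun x _ ↦ norm_nonneg _).trans hD
  have hC₀nn : 0 ≤ C₀ := by positivity
  have hC₁nn : 0 ≤ C₁ := by positivity
  have hint : (∫ x in (-a)..a, ‖h x‖) ≤ C₀ := by
    calc (∫ x in (-a)..a, ‖h x‖) ≤ ∫ x in (-a)..a, M :=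
          intervalIntegral.integral_mono_on haa (hhc.norm.intervalIntegrable _ _)
            intervalIntegrable_const fun x hx ↦ hM x hx
      _ = C₀ := by rw [intervalIntegral.integral_const, smul_eq_mul]; ring
  have h0 : ‖∫ x in (-a)..a, h x * oscFactor t x‖ ≤ C₀ :=
    (norm_intervalIntegral_mul_cexp_le_integral_norm haa t).trans hint
  have hpos : 0 < 1 + |t| := by positivity
  rw [le_div_iff₀ hpos]
  by_cases ht : |t| ≤ 1
  · calc ‖∫ x in (-a)..a, h x * oscFactor t x‖ * (1 + |t|) ≤ C₀ * 2 :=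
          mul_le_mul h0 (by linarith) hpos.le hC₀nn
      _ ≤ 2 * max C₀ C₁ := by linarith [le_max_left C₀ C₁]
  · push Not at ht
    have ht0 : t ≠ 0 := by intro h0'; rw [h0', abs_zero] at ht; linarith
    have h1 : ‖∫ x in (-a)..a, h x * oscFactor t x‖ ≤ C₁ / |t| := by
      refine (norm_intervalIntegral_mul_cexp_le haa (fun x _ ↦ hh x) hh' ht0).trans ?_
      refine div_le_div_of_nonneg_right ?_ (abs_nonneg t)
      have e1 : ‖h (-a)‖ ≤ M := hM _ ⟨le_rfl, haa⟩
      have e2 : ‖h a‖ ≤ M := hM _ ⟨haa, le_rfl⟩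
      linarith
    have htpos : 0 < |t| := by linarith
    calc ‖∫ x in (-a)..a, h x * oscFactor t x‖ * (1 + |t|)
        ≤ C₁ / |t| * (1 + |t|) := by gcongr
      _ = C₁ * ((1 + |t|) / |t|) := by ring
      _ ≤ C₁ * 2 := by
          refine mul_le_mul_of_nonneg_left ?_ hC₁nn
          rw [div_le_iff₀ htpos]; linarith
      _ ≤ 2 * max C₀ C₁ := by linarith [le_max_right C₀ C₁]

/-- **From critical-line decay to the archimedean majorant**: if `‖(cutoffAt b h)^(½+it)‖ ≤ C/(1+|t|)`
for all `t`, the archimedean integrand of `autocorrAt b h` is `≤ 16 C² (1+|t|)^{-3/2}`. [folklore] -/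
theorem norm_weilArchIntegrand_autocorrAt_le_of_decay {h : ℝ → ℂ} (hhc : Continuous h) {b C : ℝ}
    (hC : ∀ t : ℝ, ‖weilMellin (cutoffAt b h) (1 / 2 + t * I)‖ ≤ C / (1 + |t|)) (t : ℝ) :
    ‖weilMellin (autocorrAt b h) (1 / 2 + t * I) * ((Complex.digamma (1 / 4 + t / 2 * I)).re : ℂ)‖ ≤
      C ^ 2 * 16 * (1 + ‖t‖) ^ (-(3 / 2 : ℝ)) := by
  rw [norm_mul, norm_weilMellin_autocorr_half (integrable_cutoffAt hhc b)]
  have hu : 0 < 1 + |t| := by positivity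
  have hψ : ‖((Complex.digamma (1 / 4 + t / 2 * I)).re : ℂ)‖ ≤ 16 * (1 + |t|) ^ (1 / 2 : ℝ) := by
    rw [Complex.norm_real, Real.norm_eq_abs]
    have h1 := abs_re_digamma_quarter_le_log t
    have hlog3 : Real.log (3 + |t|) ≤ Real.log 3 + Real.log (1 + |t|) := by
      rw [← Real.log_mul (by norm_num) (by positivity)]
      exact Real.log_le_log (by positivity) (by linarith [abs_nonneg t])
    have hl3 : Real.log 3 ≤ 2 := by
      have := Real.log_le_sub_one_of_pos (show (0 : ℝ) < 3 by norm_num)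
      linarith
    have hs1 : 1 ≤ (1 + |t|) ^ (1 / 2 : ℝ) :=
      Real.one_le_rpow (by linarith [abs_nonneg t]) (by norm_num)
    have hlog : Real.log (1 + |t|) ≤ 2 * (1 + |t|) ^ (1 / 2 : ℝ) := by
      have h := Real.log_le_rpow_div (x := 1 + |t|) (ε := 1 / 2) (by positivity) (by norm_num)
      calc Real.log (1 + |t|) ≤ (1 + |t|) ^ (1 / 2 : ℝ) / (1 / 2) := h
        _ = 2 * (1 + |t|) ^ (1 / 2 : ℝ) := by ring
    linarith
  have hCt : 0 ≤ C / (1 + |t|) := (norm_nonneg _).trans (hC t)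
  have hsq : ‖weilMellin (cutoffAt b h) (1 / 2 + t * I)‖ ^ 2 ≤ (C / (1 + |t|)) ^ 2 :=
    pow_le_pow_left₀ (norm_nonneg _) (hC t) 2
  have hrpow : (C / (1 + |t|)) ^ 2 * (16 * (1 + |t|) ^ (1 / 2 : ℝ)) =
      C ^ 2 * 16 * (1 + ‖t‖) ^ (-(3 / 2 : ℝ)) := by
    rw [Real.norm_eq_abs, div_pow]
    have hu' : (1 + |t|) ^ 2 = (1 + |t|) ^ (2 : ℝ) := by norm_cast
    rw [hu']
    have e1 : (1 + |t|) ^ (-(3 / 2 : ℝ)) = (1 + |t|) ^ (1 / 2 : ℝ) / (1 + |t|) ^ (2 : ℝ) := by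
      rw [← Real.rpow_sub hu]; norm_num
    rw [e1]
    field_simp
  calc ‖weilMellin (cutoffAt b h) (1 / 2 + t * I)‖ ^ 2 *
        ‖((Complex.digamma (1 / 4 + t / 2 * I)).re : ℂ)‖
      ≤ (C / (1 + |t|)) ^ 2 * (16 * (1 + |t|) ^ (1 / 2 : ℝ)) :=
        mul_le_mul hsq hψ (norm_nonneg _) (by positivity)
    _ = C ^ 2 * 16 * (1 + ‖t‖) ^ (-(3 / 2 : ℝ)) := hrpow

/-! ## §5 The archimedean integral and the assembled functional along the sequence -/

/-- **Archimedean integral** along the sequence (dominated convergence with the uniform majorant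
`16 C(a,M,D)² (1+|t|)^{-3/2}`). [folklore] -/
theorem tendsto_weilArchIntegral_autocorrAt_seq {F' : ℕ → ℝ → ℂ} {D : ℝ} (ha : 0 ≤ a)
    (hF : ∀ N x, HasDerivAt (F N) (F' N x) x) (hF' : ∀ N, Continuous (F' N)) (hfc : Continuous f)
    (hM : ∀ N, ∀ x ∈ Icc (-a) a, ‖F N x‖ ≤ M) (hD : ∀ N, (∫ x in (-a)..a, ‖F' N x‖) ≤ D)
    (hpt : ∀ x ∈ Icc (-a) a, Tendsto (fun N ↦ F N x) atTop (𝓝 (f x))) :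
    Tendsto (fun N ↦ weilArchIntegral (autocorrAt a (F N))) atTop
      (𝓝 (weilArchIntegral (autocorrAt a f))) := by
  have hFc : ∀ N, Continuous (F N) :=
    fun N ↦ continuous_iff_continuousAt.2 fun x ↦ (hF N x).continuousAt
  have hM0 : 0 ≤ M := (norm_nonneg _).trans (hM 0 0 ⟨by linarith, ha⟩)
  set C : ℝ := 2 * max (2 * a * M) (2 * M + D)
  have hdec : ∀ N (t : ℝ), ‖weilMellin (cutoffAt a (F N)) (1 / 2 + t * I)‖ ≤ C / (1 + |t|) :=
    fun N t ↦ norm_weilMellin_cutoffAt_half_le_of_bounds ha (hF N) (hF' N) hM0 (hM N) (hD N) t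
  unfold weilArchIntegral
  refine tendsto_integral_of_dominated_convergence (fun t : ℝ ↦ C ^ 2 * 16 * (1 + ‖t‖) ^ (-(3 / 2 : ℝ)))
    (fun N ↦ (continuous_weilArchIntegrand_autocorrAt (hFc N) ha).aestronglyMeasurable)
    (integrable_majorant_threeHalves _)
    (fun N ↦ Eventually.of_forall fun t ↦
      norm_weilArchIntegrand_autocorrAt_le_of_decay (hFc N) (hdec N) t)
    (Eventually.of_forall fun t ↦ ?_)
  have e : ∀ h : ℝ → ℂ, Continuous h → weilMellin (autocorrAt a h) (1 / 2 + t * I) =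
      (Complex.normSq (weilMellin (cutoffAt a h) (1 / 2 + t * I)) : ℂ) :=
    fun h hh ↦ weilMellin_autocorr_half (integrable_cutoffAt hh a) t
  have e' : (fun N ↦ weilMellin (autocorrAt a (F N)) (1 / 2 + t * I) *
      ((Complex.digamma (1 / 4 + t / 2 * I)).re : ℂ)) = fun N ↦
      (Complex.normSq (weilMellin (cutoffAt a (F N)) (1 / 2 + t * I)) : ℂ) *
        ((Complex.digamma (1 / 4 + t / 2 * I)).re : ℂ) := funext fun N ↦ by rw [e _ (hFc N)]
  rw [e', e f hfc]
  exact (((continuous_ofReal.comp Complex.continuous_normSq).tendsto _).comp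
    (tendsto_weilMellin_cutoffAt_seq ha hFc hM hpt _)).mul_const _

/-- **`W(autocorrAt a F_N) → W(autocorrAt a f)`** along a `C¹` sequence uniformly bounded on the window,
with uniformly `L¹`-bounded derivatives, converging pointwise on the window. [folklore] -/
theorem tendsto_weilFunctional_autocorrAt_seq {F' : ℕ → ℝ → ℂ} {D : ℝ} (ha : 0 ≤ a)
    (hF : ∀ N x, HasDerivAt (F N) (F' N x) x) (hF' : ∀ N, Continuous (F' N)) (hfc : Continuous f)
    (hM : ∀ N, ∀ x ∈ Icc (-a) a, ‖F N x‖ ≤ M) (hD : ∀ N, (∫ x in (-a)..a, ‖F' N x‖) ≤ D)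
    (hpt : ∀ x ∈ Icc (-a) a, Tendsto (fun N ↦ F N x) atTop (𝓝 (f x))) :
    Tendsto (fun N ↦ weilFunctional (autocorrAt a (F N))) atTop
      (𝓝 (weilFunctional (autocorrAt a f))) := by
  have hFc : ∀ N, Continuous (F N) :=
    fun N ↦ continuous_iff_continuousAt.2 fun x ↦ (hF N x).continuousAt
  have hP := tendsto_weilPolarTerm_autocorrAt_seq ha hFc hfc hM hpt
  have hPr := tendsto_weilPrimeTerm_autocorrAt_seq hFc hM hpt
  have hA := tendsto_weilArchIntegral_autocorrAt_seq ha hF hF' hfc hM hD hpt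
  have h0 := tendsto_autocorrAt_apply_seq hFc hM hpt 0
  unfold weilFunctional weilArchTerm
  exact (hP.sub hPr).add ((hA.const_mul _).sub (h0.mul_const _))

/-- **Form and mass along a profile sequence at fixed radius**, packaged (the GAL-1 (ii′) engine).
[folklore] -/
theorem tendsto_form_and_mass_cutoffAt_seq {F' : ℕ → ℝ → ℂ} {D : ℝ} (ha : 0 ≤ a)
    (hF : ∀ N x, HasDerivAt (F N) (F' N x) x) (hF' : ∀ N, Continuous (F' N)) (hfc : Continuous f)
    (hM : ∀ N, ∀ x ∈ Icc (-a) a, ‖F N x‖ ≤ M) (hD : ∀ N, (∫ x in (-a)..a, ‖F' N x‖) ≤ D)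
    (hpt : ∀ x ∈ Icc (-a) a, Tendsto (fun N ↦ F N x) atTop (𝓝 (f x))) :
    Tendsto (fun N ↦ weilFunctional (autocorrAt a (F N))) atTop
        (𝓝 (weilFunctional (autocorrAt a f))) ∧
      Tendsto (fun N ↦ ∫ t, ‖cutoffAt a (F N) t‖ ^ 2) atTop (𝓝 (∫ t, ‖cutoffAt a f t‖ ^ 2)) :=
  ⟨tendsto_weilFunctional_autocorrAt_seq ha hF hF' hfc hM hD hpt,
    tendsto_integral_norm_sq_cutoffAt_seq ha
      (fun N ↦ continuous_iff_continuousAt.2 fun x ↦ (hF N x).continuousAt) hM hpt⟩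

end Summit.RiemannHypothesis.RiemannHypothesis.Theorems.PfPersistence
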